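import Mathlib.Order.Directed
import Literature.AnabelianGeometry.SemiGraphs.TemperedGroups
import HarnessLib

/-!
# Semi-graphs of anabelioids, §3: tempered groups ARE inverse limits of countable discrete groups

Mochizuki, *Semi-graphs of anabelioids*, Publ. RIMS **42** (2006), §3 Definition 3.1 (i), p. 33
[cite: MochizukiSemiAnbd2006, Def 3.1(i) p.33]: "If `Π` may be written as an inverse limit of an
inverse system of surjections of countable discrete topological groups, then we shall say that `Π` is
tempered." The tree's `IsTempered` (`TemperedGroups.lean`) is the intrinsic reformulation (open
normal subgroups of countable index form a basis of neighbourhoods of `1`; they separate points;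
compatible families of cosets come from elements). This file PROVES the two formulations equivalent
for topological groups (`isTempered_iff_nonempty_limitPresentation`), so that the reformulation is a
theorem and not a modelling choice (cell abc-iut, modelling flag of abc-iut-L3-lead 2026-08-25):

* `CountableDiscreteSystem` — an inverse system of countable discrete groups with surjective
  transition maps over a nonempty directed preorder, its limit `CountableDiscreteSystem.limit` (the
  closed subgroup of compatible families in the product, with the product topology);
* `IsTempered.limitPresentation` — a tempered group is isomorphic, as a topological group, to the
  limit of the system of its countable discrete quotients `Π/N`;
* `IsTempered.of_limitPresentation` — conversely such a limit (and anything isomorphic to it) is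
  tempered;
* `temperedAction_iff_continuousSMul` — a `Π`-set `X` (as the object `Action.ofMulAction Π X`) lies
  in `B^temp(Π)` ("countable, discrete sets equipped with a continuous `Π`-action", p. 33) iff `X` is
  countable and the action is continuous for the discrete topology on `X` (Mathlib
  `continuousSMul_iff_stabilizer_isOpen`).

The empty inverse system (limit = the trivial group) is excluded by `Nonempty ι`; the trivial group
is tempered anyway. No statement of the paper is strengthened.
-/

open Topology Filter

namespace Literature.AnabelianGeometry.SemiGraphs

universe u

/-! ### Inverse systems of countable discrete groups -/

/-- An inverse system of countable discrete groups with surjective transition maps, indexed by a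
nonempty directed preorder ("an inverse system of surjections of countable discrete topological
groups", SemiAnbd Def. 3.1 (i) p. 33). [cite: MochizukiSemiAnbd2006, Def 3.1(i) p.33] -/
structure CountableDiscreteSystem : Type (u + 1) where
  /-- the index preorder -/
  ι : Type u
  [preorder : Preorder ι]
  [isDirected : IsDirected ι (· ≤ ·)]
  [nonempty : Nonempty ι]
  /-- the groups `Π_i` -/
  obj : ι → Type u
  [group : ∀ i, Group (obj i)]
  [topologicalSpace : ∀ i, TopologicalSpace (obj i)]
  [discreteTopology : ∀ i, DiscreteTopology (obj i)]
  /-- the `Π_i` are countable -/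
  countable : ∀ i, Countable (obj i)
  /-- the transition maps `Π_j ↠ Π_i` for `i ≤ j` -/
  map : ∀ ⦃i j : ι⦄, i ≤ j → obj j →* obj i
  /-- identities -/
  map_self : ∀ (i : ι) (x : obj i), map le_rfl x = x
  /-- composition -/
  map_map : ∀ ⦃i j k : ι⦄ (hij : i ≤ j) (hjk : j ≤ k) (x : obj k),
    map hij (map hjk x) = map (hij.trans hjk) x
  /-- the transition maps are surjective -/
  map_surjective : ∀ ⦃i j : ι⦄ (h : i ≤ j), Function.Surjective (map h)

namespace CountableDiscreteSystem

attribute [instance] preorder isDirected nonempty group topologicalSpace discreteTopology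

variable (S : CountableDiscreteSystem.{u})

/-- Discrete groups are topological groups. [folklore] -/
instance (i : S.ι) : IsTopologicalGroup (S.obj i) where
  continuous_mul := continuous_of_discreteTopology
  continuous_inv := continuous_of_discreteTopology

/-- The inverse limit `lim Π_i`: compatible families, a subgroup of `∏ Π_i` (topologised as a
subspace of the product of the discrete `Π_i`). [cite: MochizukiSemiAnbd2006, Def 3.1(i) p.33] -/
def limit : Subgroup (∀ i, S.obj i) where
  carrier := {x | ∀ ⦃i j : S.ι⦄ (h : i ≤ j), S.map h (x j) = x i}
  one_mem' := by intro i j h; simp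
  mul_mem' := by
    intro a b ha hb i j h
    simp only [Pi.mul_apply, map_mul, ha h, hb h]
  inv_mem' := by
    intro a ha i j h
    simp only [Pi.inv_apply, map_inv, ha h]

/-- Membership in the limit. [cite: MochizukiSemiAnbd2006, Def 3.1(i) p.33] -/
theorem mem_limit_iff (x : ∀ i, S.obj i) :
    x ∈ S.limit ↔ ∀ ⦃i j : S.ι⦄ (h : i ≤ j), S.map h (x j) = x i := Iff.rfl

/-- The projections `lim Π_i → Π_k`. [cite: MochizukiSemiAnbd2006, Def 3.1(i) p.33] -/
def proj (k : S.ι) : S.limit →* S.obj k := (Pi.evalMonoidHom S.obj k).comp S.limit.subtype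

/-- The projections are continuous. [cite: MochizukiSemiAnbd2006, Def 3.1(i) p.33] -/
theorem continuous_proj (k : S.ι) : Continuous (S.proj k) :=
  (continuous_apply k).comp continuous_subtype_val

end CountableDiscreteSystem

/-! ### A limit presentation forces temperedness -/

section OfLimit

variable {G : Type u} [Group G] [TopologicalSpace G]
  (S : CountableDiscreteSystem.{u}) (e : G ≃ₜ* S.limit)

/-- The kernel of `G ≃ lim Π_i → Π_k`, an open normal subgroup of `G`. [folklore] -/
private def kerAt (k : S.ι) : OpenNormalSubgroup G :=
  { toSubgroup := ((S.proj k).comp e.toMonoidHom).ker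
    isOpen' := by
      change IsOpen (((S.proj k).comp e.toMonoidHom) ⁻¹' {1})
      exact (isOpen_discrete {(1 : S.obj k)}).preimage ((S.continuous_proj k).comp e.continuous) }

/-- Membership in `kerAt`. [folklore] -/
private theorem mem_kerAt_iff (k : S.ι) (g : G) : g ∈ kerAt S e k ↔ (e g).1 k = 1 := Iff.rfl

/-- The kernels decrease along the index order. [folklore] -/
private theorem kerAt_anti {k l : S.ι} (h : k ≤ l) : (kerAt S e l : Set G) ⊆ kerAt S e k := by
  intro g hg
  rw [SetLike.mem_coe, mem_kerAt_iff] at hg ⊢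
  rw [← (e g).2 h, hg, map_one]

/-- The kernels have countable index. [folklore] -/
private theorem countable_quotient_kerAt (k : S.ι) : Countable (G ⧸ (kerAt S e k).toSubgroup) := by
  haveI := S.countable k
  exact Countable.of_equiv _ (QuotientGroup.quotientKerEquivRange ((S.proj k).comp e.toMonoidHom)).symm.toEquiv

/-- The kernels form a basis of neighbourhoods of `1`. [folklore] -/
private theorem exists_kerAt_subset {U : Set G} (hU : U ∈ 𝓝 (1 : G)) :
    ∃ k, (kerAt S e k : Set G) ⊆ U := by
  -- transport `U` to the limit and read off a basic neighbourhood of the product topology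
  have h1 : e.symm ⁻¹' U ∈ 𝓝 (1 : S.limit) := by
    apply e.symm.continuous.continuousAt.preimage_mem_nhds
    simpa using hU
  obtain ⟨u, hu, hsub⟩ := (mem_nhds_subtype _ _ _).mp h1
  rw [Subgroup.coe_one, nhds_pi, Filter.mem_pi] at hu
  obtain ⟨I, hI, t, ht, hIt⟩ := hu
  obtain ⟨k, hk⟩ := hI.toFinset.exists_le
  refine ⟨k, fun g hg => ?_⟩
  have hmem : (e g).1 ∈ I.pi t := by
    intro i hi
    have hik : i ≤ k := hk i (hI.mem_toFinset.mpr hi)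
    have : (e g).1 i = 1 := by
      rw [← (e g).2 hik, (mem_kerAt_iff S e k g).mp hg, map_one]
    rw [this]
    have := ht i
    rwa [nhds_discrete, Filter.mem_pure] at this
  have : e g ∈ e.symm ⁻¹' U := hsub (hIt hmem)
  simpa using this

/-- **Definition 3.1 (i), extrinsic ⇒ intrinsic**: a topological group isomorphic to the inverse
limit of an inverse system of surjections of countable discrete groups is tempered in the sense of
`IsTempered`. [cite: MochizukiSemiAnbd2006, Def 3.1(i) p.33] -/
theorem IsTempered.of_limitPresentation {G : Type u} [Group G] [TopologicalSpace G]
    (S : CountableDiscreteSystem.{u}) (e : G ≃ₜ* S.limit) : IsTempered G where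
  basis U hU := by
    obtain ⟨k, hk⟩ := exists_kerAt_subset S e hU
    exact ⟨kerAt S e k, countable_quotient_kerAt S e k, hk⟩
  separated g hg := by
    have : (e g).1 ≠ 1 := by
      intro h
      apply hg
      have : e g = 1 := Subtype.ext h
      simpa using congrArg e.symm this
    obtain ⟨k, hk⟩ := Function.ne_iff.mp this
    exact ⟨kerAt S e k, fun h => hk ((mem_kerAt_iff S e k g).mp h)⟩
  complete z hz := by
    classical
    -- representatives of the cosets at the kernels `kerAt k`
    set r : S.ι → G := fun k => (z (kerAt S e k)).out with hr
    have hrz : ∀ k, z (kerAt S e k) = (r k : G ⧸ (kerAt S e k).toSubgroup) := fun k =>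
      (QuotientGroup.out_eq' _).symm
    -- the candidate compatible family
    set x : ∀ i, S.obj i := fun i => (e (r i)).1 i with hx
    have hcompat : ∀ ⦃i j : S.ι⦄ (h : i ≤ j), (e (r i)).1 i = (e (r j)).1 i := by
      intro i j h
      have hij : z (kerAt S e i) = (r j : G ⧸ (kerAt S e i).toSubgroup) :=
        hz _ _ (kerAt_anti S e h) (r j) (hrz j)
      rw [hrz i, QuotientGroup.eq] at hij
      have hij' := (mem_kerAt_iff S e i _).mp hij
      simp only [map_mul, map_inv, Subgroup.coe_mul, Subgroup.coe_inv, Pi.mul_apply,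
        Pi.inv_apply, inv_mul_eq_one] at hij'
      exact hij'
    have hxmem : x ∈ S.limit := by
      intro i j h
      simp only [hx]
      rw [(e (r j)).2 h, hcompat h]
    refine ⟨e.symm ⟨x, hxmem⟩, fun N => ?_⟩
    obtain ⟨k, hk⟩ := exists_kerAt_subset S e (N.toOpenSubgroup.mem_nhds_one)
    have hNk : z N = (r k : G ⧸ N.toSubgroup) := hz _ _ hk (r k) (hrz k)
    rw [hNk, QuotientGroup.eq]
    apply hk
    rw [SetLike.mem_coe, mem_kerAt_iff, map_mul, map_inv, Subgroup.coe_mul, Subgroup.coe_inv,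
      Pi.mul_apply, Pi.inv_apply, inv_mul_eq_one, ContinuousMulEquiv.apply_symm_apply]

end OfLimit

/-! ### A tempered group is the limit of its countable discrete quotients -/

section ToLimit

variable {G : Type u} [Group G] [TopologicalSpace G]

/-- The index set: open normal subgroups of countable index (ordered below by REVERSE inclusion).
[folklore] -/
private structure Idx (G : Type u) [Group G] [TopologicalSpace G] : Type u where
  /-- the open normal subgroup -/
  N : OpenNormalSubgroup G
  /-- it has countable index -/
  countable : Countable (G ⧸ N.toSubgroup)

/-- Reverse inclusion. [folklore] -/
private instance : Preorder (Idx G) where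
  le i j := (j.N : Set G) ⊆ i.N
  le_refl _ := subset_rfl
  le_trans _ _ _ hij hjk := hjk.trans hij

/-- Unfolding the order. [folklore] -/
private theorem Idx.le_def {i j : Idx G} : i ≤ j ↔ (j.N : Set G) ⊆ i.N := Iff.rfl

/-- Intersections of countable-index open normal subgroups have countable index. [folklore] -/
private theorem countable_quotient_inf (N M : OpenNormalSubgroup G) (hN : Countable (G ⧸ N.toSubgroup))
    (hM : Countable (G ⧸ M.toSubgroup)) : Countable (G ⧸ (N ⊓ M).toSubgroup) := by
  classical
  let f : G ⧸ (N ⊓ M).toSubgroup → (G ⧸ N.toSubgroup) × (G ⧸ M.toSubgroup) :=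
    fun q => (Subgroup.quotientMapOfLE (inf_le_left : (N ⊓ M).toSubgroup ≤ N.toSubgroup) q,
      Subgroup.quotientMapOfLE (inf_le_right : (N ⊓ M).toSubgroup ≤ M.toSubgroup) q)
  refine Function.Injective.countable (f := f) ?_
  rintro ⟨a⟩ ⟨b⟩ h
  simp only [f, Prod.mk.injEq] at h
  obtain ⟨h1, h2⟩ := h
  change Subgroup.quotientMapOfLE _ (a : G ⧸ (N ⊓ M).toSubgroup) = Subgroup.quotientMapOfLE _ b at h1
  change Subgroup.quotientMapOfLE _ (a : G ⧸ (N ⊓ M).toSubgroup) = Subgroup.quotientMapOfLE _ b at h2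
  rw [Subgroup.quotientMapOfLE_apply_mk, Subgroup.quotientMapOfLE_apply_mk, QuotientGroup.eq] at h1 h2
  change (a : G ⧸ (N ⊓ M).toSubgroup) = b
  rw [QuotientGroup.eq]
  exact ⟨h1, h2⟩

/-- The index set is directed (intersect). [folklore] -/
private instance Idx.instIsDirected : IsDirected (Idx G) (· ≤ ·) :=
  ⟨fun i j => ⟨⟨i.N ⊓ j.N, countable_quotient_inf i.N j.N i.countable j.countable⟩,
    fun g hg => (hg : g ∈ (i.N ⊓ j.N : OpenNormalSubgroup G)).1,
    fun g hg => (hg : g ∈ (i.N ⊓ j.N : OpenNormalSubgroup G)).2⟩⟩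

/-- The index set is nonempty (the whole group). [folklore] -/
private instance : Nonempty (Idx G) :=
  ⟨⟨{ toOpenSubgroup := ⊤, isNormal' := by change (⊤ : Subgroup G).Normal; infer_instance },
    by change Countable (G ⧸ (⊤ : Subgroup G)); infer_instance⟩⟩

/-- For a tempered group the indices form a basis of neighbourhoods of `1`. [folklore] -/
private theorem exists_idx_subset (hG : IsTempered G) {U : Set G} (hU : U ∈ 𝓝 (1 : G)) :
    ∃ i : Idx G, (i.N : Set G) ⊆ U := by
  obtain ⟨N, hN, hNU⟩ := hG.basis U hU
  exact ⟨⟨N, hN⟩, hNU⟩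

variable [IsTopologicalGroup G]

variable (G) in
/-- The system of countable discrete quotients `Π/N` of `Π`. [cite: MochizukiSemiAnbd2006, Def 3.1(i) p.33] -/
private def quotSystem : CountableDiscreteSystem.{u} where
  ι := Idx G
  obj i := G ⧸ i.N.toSubgroup
  countable i := i.countable
  map _ _ h := QuotientGroup.map _ _ (MonoidHom.id G) fun _ hg => Idx.le_def.mp h hg
  map_self _ x := QuotientGroup.induction_on x fun _ => rfl
  map_map _ _ _ _ _ x := QuotientGroup.induction_on x fun _ => rfl
  map_surjective _ j _ x := QuotientGroup.induction_on x fun g => ⟨(g : G ⧸ j.N.toSubgroup), rfl⟩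

variable (G) in
/-- The canonical homomorphism `Π → lim Π/N`. [folklore] -/
private def toQuotSystem : G →* (quotSystem G).limit where
  toFun g := ⟨fun i => (g : G ⧸ i.N.toSubgroup), fun _ _ _ => rfl⟩
  map_one' := Subtype.ext (funext fun _ => rfl)
  map_mul' _ _ := Subtype.ext (funext fun _ => rfl)

/-- Components of the canonical map. [folklore] -/
private theorem toQuotSystem_apply (g : G) (i : Idx G) :
    (toQuotSystem G g).1 i = (g : G ⧸ i.N.toSubgroup) := rfl

/-- Injectivity of `Π → lim Π/N` (from `separated` and `basis`). [folklore] -/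
private theorem toQuotSystem_injective (hG : IsTempered G) : Function.Injective (toQuotSystem G) := by
  rw [← MonoidHom.ker_eq_bot_iff, Subgroup.eq_bot_iff_forall]
  intro g hg
  by_contra hne
  obtain ⟨N, hN⟩ := hG.separated g hne
  obtain ⟨i, hi⟩ := exists_idx_subset hG (N.toOpenSubgroup.mem_nhds_one)
  have h1 : (g : G ⧸ i.N.toSubgroup) = ((1 : G) : G ⧸ i.N.toSubgroup) :=
    congrFun (congrArg Subtype.val hg) i
  rw [QuotientGroup.eq, mul_one, inv_mem_iff] at h1
  exact hN (hi h1)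

/-- Surjectivity of `Π → lim Π/N` (from `complete` and `basis`). [folklore] -/
private theorem toQuotSystem_surjective (hG : IsTempered G) :
    Function.Surjective (toQuotSystem G) := by
  classical
  intro y
  -- extend the compatible family `y` from countable-index subgroups to all open normal subgroups
  have hc : ∀ M : OpenNormalSubgroup G, ∃ i : Idx G, (i.N : Set G) ⊆ M := fun M =>
    exists_idx_subset hG (M.toOpenSubgroup.mem_nhds_one)
  choose c hc using hc
  let z : ∀ M : OpenNormalSubgroup G, G ⧸ M.toSubgroup := fun M =>
    Subgroup.quotientMapOfLE (fun g hg => hc M hg) (y.1 (c M))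
  -- value of `z M` through any index below `M`
  have hzval : ∀ (M : OpenNormalSubgroup G) (i : Idx G), (i.N : Set G) ⊆ M → ∀ (g : G),
      y.1 i = (g : G ⧸ i.N.toSubgroup) → z M = (g : G ⧸ M.toSubgroup) := by
    intro M i hi g hg
    obtain ⟨k, hk1, hk2⟩ := (Idx.instIsDirected (G := G)).directed i (c M)
    obtain ⟨r, hr⟩ := QuotientGroup.mk_surjective (y.1 k)
    have hyi : y.1 i = (r : G ⧸ i.N.toSubgroup) := by rw [← y.2 hk1, ← hr]; rfl
    have hyc : y.1 (c M) = (r : G ⧸ (c M).N.toSubgroup) := by rw [← y.2 hk2, ← hr]; rfl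
    have hzr : z M = (r : G ⧸ M.toSubgroup) := by
      simp only [z, hyc, Subgroup.quotientMapOfLE_apply_mk]
    rw [hzr, QuotientGroup.eq]
    rw [hyi] at hg
    change (r : G ⧸ i.N.toSubgroup) = (g : G ⧸ i.N.toSubgroup) at hg
    rw [QuotientGroup.eq] at hg
    exact hi hg
  have hz : ∀ N M : OpenNormalSubgroup G, N ≤ M → ∀ g : G,
      z N = (g : G ⧸ N.toSubgroup) → z M = (g : G ⧸ M.toSubgroup) := by
    intro N M hNM g hg
    obtain ⟨r, hr⟩ := QuotientGroup.mk_surjective (y.1 (c N))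
    have h1 : z N = (r : G ⧸ N.toSubgroup) := hzval N (c N) (hc N) r hr.symm
    have h2 : z M = (r : G ⧸ M.toSubgroup) := hzval M (c N) ((hc N).trans hNM) r hr.symm
    rw [h1, QuotientGroup.eq] at hg
    rw [h2, QuotientGroup.eq]
    exact hNM hg
  obtain ⟨g, hg⟩ := hG.complete z hz
  refine ⟨g, Subtype.ext (funext fun i => ?_)⟩
  obtain ⟨r, hr⟩ := QuotientGroup.mk_surjective (y.1 i)
  have := hzval i.N i subset_rfl r hr.symm
  rw [hg i.N] at this
  rw [toQuotSystem_apply, ← hr]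
  exact this

/-- **Definition 3.1 (i), intrinsic ⇒ extrinsic**: a tempered topological group is isomorphic, as a
topological group, to the inverse limit of the inverse system of its countable discrete quotients
`Π/N` (with surjective transition maps). [cite: MochizukiSemiAnbd2006, Def 3.1(i) p.33] -/
theorem IsTempered.limitPresentation (hG : IsTempered G) :
    ∃ S : CountableDiscreteSystem.{u}, Nonempty (G ≃ₜ* S.limit) := by
  classical
  refine ⟨quotSystem G, ⟨?_⟩⟩
  let f := MulEquiv.ofBijective (toQuotSystem G)
    ⟨toQuotSystem_injective hG, toQuotSystem_surjective hG⟩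
  have hf : Continuous f := by
    apply continuous_induced_rng.mpr
    exact continuous_pi fun i => QuotientGroup.continuous_mk
  have hfs : Continuous f.symm := by
    refine continuous_of_continuousAt_one f.symm ?_
    rw [ContinuousAt, map_one]
    intro U hU
    obtain ⟨i, hi⟩ := exists_idx_subset hG hU
    have hopen : IsOpen {y : (quotSystem G).limit | y.1 i = 1} :=
      (isOpen_discrete {(1 : G ⧸ i.N.toSubgroup)}).preimage ((quotSystem G).continuous_proj i)
    have h1mem : (1 : (quotSystem G).limit) ∈ {y : (quotSystem G).limit | y.1 i = 1} := rfl
    apply Filter.mem_of_superset (hopen.mem_nhds h1mem)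
    intro y hy
    rw [Set.mem_preimage]
    apply hi
    have h1 : ((f.symm y : G) : G ⧸ i.N.toSubgroup) = ((1 : G) : G ⧸ i.N.toSubgroup) := by
      have : (f (f.symm y)).1 i = y.1 i := by rw [MulEquiv.apply_symm_apply]
      rw [hy] at this
      exact this
    rw [QuotientGroup.eq, mul_one, inv_mem_iff] at h1
    exact h1
  exact { f with continuous_toFun := hf, continuous_invFun := hfs }

end ToLimit

/-- **Definition 3.1 (i)** ([SemiAnbd] §3 p. 33): the tree's intrinsic `IsTempered` is EQUIVALENT to
the printed definition — "`Π` may be written as an inverse limit of an inverse system of surjections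
of countable discrete topological groups". [cite: MochizukiSemiAnbd2006, Def 3.1(i) p.33] -/
theorem isTempered_iff_nonempty_limitPresentation {G : Type u} [Group G] [TopologicalSpace G]
    [IsTopologicalGroup G] :
    IsTempered G ↔ ∃ S : CountableDiscreteSystem.{u}, Nonempty (G ≃ₜ* S.limit) :=
  ⟨fun hG => hG.limitPresentation, fun ⟨S, ⟨e⟩⟩ => IsTempered.of_limitPresentation S e⟩

/-- `B^temp(Π)` (p. 33: "countable …, discrete sets equipped with a continuous `Π`-action"): an
object of `Action (Type u) Π` lies in `B^temp(Π)` iff its underlying set is countable and the action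
is continuous for the discrete topology. [cite: MochizukiSemiAnbd2006, §3 p.33] -/
theorem temperedAction_iff_continuousSMul {G : Type u} [Group G] [TopologicalSpace G]
    [IsTopologicalGroup G] (X : Type u) [MulAction G X] :
    temperedAction G (Action.ofMulAction G X) ↔ Countable X ∧ @ContinuousSMul G X _ _ ⊥ := by
  letI : TopologicalSpace X := ⊥
  haveI : DiscreteTopology X := ⟨rfl⟩
  rw [temperedAction_iff, continuousSMul_iff_stabilizer_isOpen]
  rfl

end Literature.AnabelianGeometry.SemiGraphs
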